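import Summits.QuantumAdvantage.AdviceFreeQNC0.LeaderElectionPolynomial
import HarnessLib

/-!
# Cell qa-qnc0 (rung F-Q1, route `RingFrame`, crux α `RingToElim`): low-degree LEADER ELECTION on
# the cycle, II — collisions, the unique leader, and `LowDegLeaderElection` (qn-p2 ROUND-7, R7-b)

Planner qa-qnc0-p2's ROUND-7 ask R7-b (`HOME/qa-qnc0-p2/ROUND-7.md` §2.4, `line/Sketch7.lean` §1b).
The statement `LowDegLeaderElection` is copied VERBATIM and PROVED (`lowDegLeaderElection`, with
`C = 4`, `n₀ = 64`): a single polynomial `e` of degree `≤ (log₂ n)^4` fires at EXACTLY ONE rotation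
of all but a `1/n` fraction of the patterns `x ∈ {0,1}ⁿ`.

Construction (continuing `LeaderElectionPolynomial.lean`): `e = elect hn ℓ t ω` for a good seed
`ω` (`exists_good_seed`), window length `ℓ = 3L + 4` and `t = 2L + 3` trials, `L = log₂ n`
(so `2^ℓ > 2n³`, `2^t > 2n²`, `2ℓ ≤ n`, `t(ℓ+1) ≤ L^4` for `n ≥ 64`).  This file supplies:

* **collisions are rare** (`card_collide`): two windows of `x` at distinct positions coincide for at
  most `n²·2ⁿ/2^ℓ` patterns — reduce by a rotation to windows at `0` and `d` with `1 ≤ d ≤ n − ℓ`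
  (the shorter cyclic offset, `2ℓ ≤ n`), where the window `[d, d+ℓ)` of a colliding pattern is
  determined by the other bits (strong induction along `j ↦ j − d`), so overwriting it is injective
  on `E × {0,1}^ℓ` (`card_window_eq_base`);
* **unique leader** (`fireCount_eq_one`): if no rotation of `x` is an error input of the seed and no
  two windows coincide, then `e(rot_b x) = [window b is the strict lex-minimum]` for every `b`
  (`good_rot_iff`), and exactly one position is the strict minimum (`card_isMin_eq_one`);
* the union bound `#{fireCount ≠ 1}·n ≤ 2ⁿ` (`card_bad_mul_le`) and the parameter bookkeeping
  (`leaderElect`).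

Label: instrument (towards the normal form N-EQ of α, `RingSymmetrization.lean`); the cell's own
elementary argument (no circuit model).  WHAT THIS IS NOT: nothing on α's truth; separation NOT moved.
-/

noncomputable section

open scoped Classical

namespace Summit.QuantumAdvantage.AdviceFreeQNC0

open Finset
open Literature.Computability.QuantumComplexity Literature.Computability.QuantumComplexity.RingHLF
open Literature.Computability.MetaComplexity Literature.Computability.MetaComplexity.Smolensky

/-! ## Sketch7 §1b statement (verbatim, planner qa-qnc0-p2) -/

/-- **LE (PROVABLE, M; in-tree `Smolensky.razborov_smolensky` (RazborovSmolenskyApprox.lean, proved) applied to the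
depth-3 poly-size circuit "window 0 carries the strict minimum label" + distinct-labels count + union bound over rotations)**: leader election succeeds with probability
`1 − 1/n` at degree `(log₂ n)^C` for some absolute `C` (the memo's construction gives `O(log² n)`).
(Sketch7, verbatim.) -/
def LowDegLeaderElection : Prop :=
  ∃ C n₀ : ℕ, ∀ n ≥ n₀, LeaderElect n ((Nat.log 2 n) ^ C) (1 / n)

namespace LeaderElection

open RingSymmetry

variable {n : ℕ}

/-! ### Window collisions are rare -/

/-- two windows of `x` coincide. -/
def Collide (hn : 0 < n) (ℓ : ℕ) (x : Fin n → Bool) : Prop :=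
  ∃ k k' : Fin n, k ≠ k' ∧ lab hn ℓ k.val x = lab hn ℓ k'.val x

/-- overwrite the window `[d, d+ℓ)` of `y` by `w`. -/
def overwrite (ℓ d : ℕ) (y : Fin n → Bool) (w : Fin ℓ → Bool) : Fin n → Bool :=
  fun j => if h : d ≤ j.val ∧ j.val < d + ℓ then w ⟨j.val - d, by omega⟩ else y j

/-- Core count: patterns whose windows at `0` and at `d` (`1 ≤ d`, `d + ℓ ≤ n`) coincide are at most
a `2^{-ℓ}` fraction — the window `[d, d+ℓ)` of such a pattern is determined by the rest (strong
induction along `j ↦ j − d`), so overwriting it is injective. -/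
theorem card_window_eq_base (hn : 0 < n) {ℓ d : ℕ} (hd : 1 ≤ d) (hdl : d + ℓ ≤ n) :
    (univ.filter fun y : Fin n → Bool => lab hn ℓ 0 y = lab hn ℓ d y).card * 2 ^ ℓ ≤ 2 ^ n := by
  set E := univ.filter fun y : Fin n → Bool => lab hn ℓ 0 y = lab hn ℓ d y with hE
  -- membership in `E`: `y i = y (i + d)` for `i < ℓ`
  have hmemE : ∀ y ∈ E, ∀ i : ℕ, ∀ hi : i < ℓ,
      y ⟨i, by omega⟩ = y ⟨i + d, by omega⟩ := by
    intro y hy i hi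
    rw [hE, mem_filter] at hy
    have h := congrFun hy.2 ⟨i, hi⟩
    simp only [lab, idx, Nat.add_zero] at h
    have e1 : (⟨i % n, Nat.mod_lt _ hn⟩ : Fin n) = ⟨i, by omega⟩ :=
      Fin.ext (Nat.mod_eq_of_lt (by omega))
    have e2 : (⟨(i + d) % n, Nat.mod_lt _ hn⟩ : Fin n) = ⟨i + d, by omega⟩ :=
      Fin.ext (Nat.mod_eq_of_lt (by omega))
    rwa [e1, e2] at h
  -- two members of `E` agreeing off the window agree everywhere
  have hdet : ∀ y ∈ E, ∀ y' ∈ E, (∀ j : Fin n, ¬ (d ≤ j.val ∧ j.val < d + ℓ) → y j = y' j) →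
      y = y' := by
    intro y hy y' hy' hoff
    funext j
    induction' hm : j.val using Nat.strong_induction_on with m ih generalizing j
    by_cases hw : d ≤ j.val ∧ j.val < d + ℓ
    · have hi : j.val - d < ℓ := by omega
      have ej : (⟨j.val - d + d, by omega⟩ : Fin n) = j := Fin.ext (by simp only; omega)
      have h1 := hmemE y hy (j.val - d) hi
      have h2 := hmemE y' hy' (j.val - d) hi
      rw [ej] at h1 h2
      rw [← h1, ← h2]
      exact ih (j.val - d) (by omega) ⟨j.val - d, by omega⟩ rfl
    · exact hoff j hw
  -- the overwriting map is injective on `E × {0,1}^ℓ`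
  have hinj : Set.InjOn (fun p : (Fin n → Bool) × (Fin ℓ → Bool) => overwrite ℓ d p.1 p.2)
      ↑(E ×ˢ (univ : Finset (Fin ℓ → Bool))) := by
    rintro ⟨y, w⟩ hp ⟨y', w'⟩ hp' h
    simp only [coe_product, Set.mem_prod, mem_coe] at hp hp'
    have hw : w = w' := by
      funext i
      have := congrFun h ⟨d + i.val, by omega⟩
      simp only [overwrite] at this
      rw [dif_pos ⟨by omega, by omega⟩, dif_pos ⟨by omega, by omega⟩] at this
      have ei : (⟨d + i.val - d, by omega⟩ : Fin ℓ) = i := Fin.ext (by simp)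
      rwa [ei] at this
    have hy : y = y' := by
      refine hdet y hp.1 y' hp'.1 fun j hj => ?_
      have := congrFun h j
      simp only [overwrite, dif_neg hj] at this
      exact this
    rw [hw, hy]
  have hcard := card_le_card_of_injOn _ (fun p _ => mem_univ (overwrite ℓ d p.1 p.2)) hinj
  rwa [card_product, card_univ, card_univ, Fintype.card_fun, Fintype.card_bool, Fintype.card_fin,
    Fintype.card_fun, Fintype.card_bool, Fintype.card_fin] at hcard

/-- Windows at two distinct positions coincide on at most a `2^{-ℓ}` fraction of the patterns
(`2ℓ ≤ n`: reduce to the base case by a rotation, using the shorter of the two cyclic offsets). -/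
theorem card_window_eq (hn : 0 < n) {ℓ : ℕ} (h2l : 2 * ℓ ≤ n) {k k' : Fin n} (hkk : k ≠ k') :
    (univ.filter fun x : Fin n → Bool => lab hn ℓ k.val x = lab hn ℓ k'.val x).card * 2 ^ ℓ ≤
      2 ^ n := by
  -- generic step: base `a`, offset `d` with `1 ≤ d`, `d + ℓ ≤ n`, second window at `a + d (mod n)`
  have step : ∀ a b d : ℕ, 1 ≤ d → d + ℓ ≤ n → (a + d) % n = b % n →
      (univ.filter fun x : Fin n → Bool => lab hn ℓ a x = lab hn ℓ b x).card * 2 ^ ℓ ≤ 2 ^ n := by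
    intro a b d hd hdl hab
    have e : (univ.filter fun x : Fin n → Bool => lab hn ℓ a x = lab hn ℓ b x) =
        univ.filter fun x : Fin n → Bool => lab hn ℓ 0 (rot a x) = lab hn ℓ d (rot a x) := by
      refine filter_congr fun x _ => ?_
      rw [lab_rot, lab_rot, Nat.zero_add, Nat.add_comm d a, lab_eq_of_mod_eq hn ℓ hab]
    rw [e, card_filter_rot a (fun y => lab hn ℓ 0 y = lab hn ℓ d y)]
    exact card_window_eq_base hn hd hdl
  have ha := k.isLt
  have hb := k'.isLt
  have hne : k.val ≠ k'.val := fun h => hkk (Fin.ext h)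
  -- symmetric in `k, k'`
  have symm : (univ.filter fun x : Fin n → Bool => lab hn ℓ k.val x = lab hn ℓ k'.val x) =
      univ.filter fun x : Fin n → Bool => lab hn ℓ k'.val x = lab hn ℓ k.val x :=
    filter_congr fun x _ => eq_comm
  rcases Nat.lt_or_gt_of_ne hne with hlt | hlt
  · by_cases hd : k'.val - k.val + ℓ ≤ n
    · exact step k.val k'.val (k'.val - k.val) (by omega) hd (by congr 1; omega)
    · rw [symm]
      exact step k'.val k.val (n - (k'.val - k.val)) (by omega) (by omega)
        (by rw [show k'.val + (n - (k'.val - k.val)) = k.val + n by omega, Nat.add_mod_right])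
  · by_cases hd : k.val - k'.val + ℓ ≤ n
    · rw [symm]
      exact step k'.val k.val (k.val - k'.val) (by omega) hd (by congr 1; omega)
    · exact step k.val k'.val (n - (k.val - k'.val)) (by omega) (by omega)
        (by rw [show k.val + (n - (k.val - k'.val)) = k'.val + n by omega, Nat.add_mod_right])

/-- **Collisions are rare**: `#{x : two windows of x coincide} · 2^ℓ ≤ n² · 2ⁿ`. -/
theorem card_collide (hn : 0 < n) {ℓ : ℕ} (h2l : 2 * ℓ ≤ n) :
    (univ.filter fun x : Fin n → Bool => Collide hn ℓ x).card * 2 ^ ℓ ≤ n ^ 2 * 2 ^ n := by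
  set F : Fin n × Fin n → Finset (Fin n → Bool) := fun p =>
    univ.filter fun x : Fin n → Bool => p.1 ≠ p.2 ∧ lab hn ℓ p.1.val x = lab hn ℓ p.2.val x with hF
  have hsub : (univ.filter fun x : Fin n → Bool => Collide hn ℓ x) ⊆
      (univ : Finset (Fin n × Fin n)).biUnion F := by
    intro x hx
    rw [mem_filter] at hx
    obtain ⟨k, k', hkk, hlab⟩ := hx.2
    rw [mem_biUnion]
    exact ⟨(k, k'), mem_univ _, by rw [hF, mem_filter]; exact ⟨mem_univ _, hkk, hlab⟩⟩
  have hterm : ∀ p : Fin n × Fin n, (F p).card * 2 ^ ℓ ≤ 2 ^ n := by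
    rintro ⟨k, k'⟩
    by_cases hkk : k = k'
    · have h0 : F (k, k') = ∅ := filter_false_of_mem fun x _ h => h.1 hkk
      rw [h0, card_empty, zero_mul]; exact Nat.zero_le _
    · have e : F (k, k') = univ.filter fun x : Fin n → Bool => lab hn ℓ k.val x = lab hn ℓ k'.val x :=
        filter_congr fun x _ => by simp [hkk]
      rw [e]; exact card_window_eq hn h2l hkk
  calc (univ.filter fun x : Fin n → Bool => Collide hn ℓ x).card * 2 ^ ℓ
      ≤ ((univ : Finset (Fin n × Fin n)).biUnion F).card * 2 ^ ℓ :=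
        Nat.mul_le_mul_right _ (card_le_card hsub)
    _ ≤ (∑ p : Fin n × Fin n, (F p).card) * 2 ^ ℓ := Nat.mul_le_mul_right _ card_biUnion_le
    _ = ∑ p : Fin n × Fin n, (F p).card * 2 ^ ℓ := Finset.sum_mul _ _ _
    _ ≤ ∑ _p : Fin n × Fin n, 2 ^ n := sum_le_sum fun p _ => hterm p
    _ = n ^ 2 * 2 ^ n := by
        rw [sum_const, card_univ, smul_eq_mul, Fintype.card_prod, Fintype.card_fin, sq]

/-! ### From `Good` at every rotation to a unique leader -/

/-- position `b` carries the STRICT lexicographic minimum of the windows of `x`. -/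
def IsMin (hn : 0 < n) (ℓ : ℕ) (x : Fin n → Bool) (b : Fin n) : Prop :=
  ∀ k : Fin n, k ≠ b → toLex (lab hn ℓ b.val x) < toLex (lab hn ℓ k.val x)

/-- `shift b k = b` iff `k = 0`. -/
theorem shift_eq_self_iff (b k : Fin n) : shift n b.val k = b ↔ k.val = 0 := by
  constructor
  · intro h
    have hv := congrArg Fin.val h
    simp only [shift] at hv
    have h1 : (k.val + b.val) % n = (0 + b.val) % n := by
      rw [hv, Nat.zero_add, Nat.mod_eq_of_lt b.isLt]
    have h2 := Nat.ModEq.add_right_cancel' b.val h1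
    have h3 : k.val % n = 0 % n := h2
    rwa [Nat.zero_mod, Nat.mod_eq_of_lt k.isLt] at h3
  · intro h
    apply Fin.ext
    simp only [shift, h, Nat.zero_add, Nat.mod_eq_of_lt b.isLt]

/-- `Good (rot b x)` says exactly that position `b` carries the strict minimum window of `x`. -/
theorem good_rot_iff (hn : 0 < n) (ℓ : ℕ) (x : Fin n → Bool) (b : Fin n) :
    Good hn ℓ (rot b.val x) ↔ IsMin hn ℓ x b := by
  unfold Good IsMin
  have hlab : ∀ k : Fin n, lab hn ℓ k.val (rot b.val x) = lab hn ℓ (shift n b.val k).val x := by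
    intro k
    rw [lab_rot]
    exact lab_eq_of_mod_eq hn ℓ (by simp [shift]) x
  have hlab0 : lab hn ℓ 0 (rot b.val x) = lab hn ℓ b.val x := by rw [lab_rot, Nat.zero_add]
  constructor
  · intro h k hk
    obtain ⟨k₁, rfl⟩ := (shift_bijective (n := n) b.val).2 k
    have hk₁ : k₁.val ≠ 0 := fun h0 => hk ((shift_eq_self_iff b k₁).2 h0)
    have := h k₁ hk₁
    rwa [hlab0, hlab] at this
  · intro h k hk
    have hne : shift n b.val k ≠ b := fun e => hk ((shift_eq_self_iff b k).1 e)
    rw [hlab0, hlab]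
    exact h _ hne

/-- Without collisions exactly one position carries the strict minimum window. -/
theorem card_isMin_eq_one (hn : 0 < n) {ℓ : ℕ} {x : Fin n → Bool} (hx : ¬ Collide hn ℓ x) :
    (univ.filter fun b : Fin n => IsMin hn ℓ x b).card = 1 := by
  obtain ⟨b₀, _, hb₀⟩ := exists_min_image univ (fun k : Fin n => toLex (lab hn ℓ k.val x))
    ⟨⟨0, hn⟩, mem_univ _⟩
  have hmin : IsMin hn ℓ x b₀ := by
    intro k hk
    refine lt_of_le_of_ne (hb₀ k (mem_univ _)) fun h => hx ⟨b₀, k, hk.symm, ?_⟩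
    exact toLex.injective h
  rw [card_eq_one]
  refine ⟨b₀, eq_singleton_iff_unique_mem.2 ⟨mem_filter.2 ⟨mem_univ _, hmin⟩, fun b hb => ?_⟩⟩
  rw [mem_filter] at hb
  by_contra hne
  exact lt_asymm (hmin b hne) (hb.2 b₀ (Ne.symm hne))

/-- If no rotation of `x` is an error input of the seed and no two windows of `x` coincide, the
election polynomial fires at EXACTLY ONE rotation of `x`. -/
theorem fireCount_eq_one (hn : 0 < n) {ℓ t : ℕ} {ω : Seed n t} {x : Fin n → Bool}
    (hE : ∀ b : Fin n, ¬ Err hn ℓ t ω (rot b.val x)) (hC : ¬ Collide hn ℓ x) :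
    fireCount (elect hn ℓ t ω) x = 1 := by
  unfold fireCount
  have e : (univ.filter fun b : Fin n => elect hn ℓ t ω (rot b.val x) = 1) =
      univ.filter fun b : Fin n => IsMin hn ℓ x b := by
    refine filter_congr fun b _ => ?_
    have h : elect hn ℓ t ω (rot b.val x) = if Good hn ℓ (rot b.val x) then 1 else 0 := by
      have := hE b
      unfold Err at this
      exact not_not.1 this
    rw [h, ← good_rot_iff]
    by_cases hg : Good hn ℓ (rot b.val x) <;> simp [hg]
  rw [e, card_isMin_eq_one hn hC]

/-! ### Assembly -/

/-- The bad set of the election polynomial is covered by the rotated error sets and the collision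
set: `#{x : fireCount ≠ 1}·n ≤ 2ⁿ` once `#Err·2^t ≤ 2ⁿ`, `2n² ≤ 2^t`, `2n³ ≤ 2^ℓ`, `2ℓ ≤ n`. -/
theorem card_bad_mul_le (hn : 0 < n) {ℓ t : ℕ} (h2l : 2 * ℓ ≤ n) (ht : 2 * n ^ 2 ≤ 2 ^ t)
    (hl : 2 * n ^ 3 ≤ 2 ^ ℓ) {ω : Seed n t}
    (hω : (univ.filter fun x : Fin n → Bool => Err hn ℓ t ω x).card * 2 ^ t ≤ 2 ^ n) :
    (univ.filter fun x : Fin n → Bool => fireCount (elect hn ℓ t ω) x ≠ 1).card * n ≤ 2 ^ n := by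
  set U₁ := univ.filter fun x : Fin n → Bool => ∃ b : Fin n, Err hn ℓ t ω (rot b.val x) with hU₁
  set U₂ := univ.filter fun x : Fin n → Bool => Collide hn ℓ x with hU₂
  have hsub : (univ.filter fun x : Fin n → Bool => fireCount (elect hn ℓ t ω) x ≠ 1) ⊆ U₁ ∪ U₂ := by
    intro x hx
    rw [mem_filter] at hx
    rw [mem_union, hU₁, hU₂, mem_filter, mem_filter]
    by_contra h
    have h1 : ∀ b : Fin n, ¬ Err hn ℓ t ω (rot b.val x) := fun b hb => h (Or.inl ⟨mem_univ _, b, hb⟩)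
    have h2 : ¬ Collide hn ℓ x := fun hc => h (Or.inr ⟨mem_univ _, hc⟩)
    exact hx.2 (fireCount_eq_one hn h1 h2)
  -- `#U₁ ≤ n · #Err`
  have hU₁le : U₁.card * 2 ^ t ≤ n * 2 ^ n := by
    have hsub1 : U₁ ⊆ (univ : Finset (Fin n)).biUnion fun b =>
        univ.filter fun x : Fin n → Bool => Err hn ℓ t ω (rot b.val x) := by
      intro x hx
      rw [hU₁, mem_filter] at hx
      obtain ⟨b, hb⟩ := hx.2
      rw [mem_biUnion]
      exact ⟨b, mem_univ _, mem_filter.2 ⟨mem_univ _, hb⟩⟩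
    calc U₁.card * 2 ^ t
        ≤ (∑ b : Fin n, (univ.filter fun x : Fin n → Bool => Err hn ℓ t ω (rot b.val x)).card) * 2 ^ t :=
          Nat.mul_le_mul_right _ ((card_le_card hsub1).trans card_biUnion_le)
      _ = (∑ _b : Fin n, (univ.filter fun x : Fin n → Bool => Err hn ℓ t ω x).card) * 2 ^ t := by
          congr 1
          exact sum_congr rfl fun b _ => card_filter_rot b.val (fun x => Err hn ℓ t ω x)
      _ = n * ((univ.filter fun x : Fin n → Bool => Err hn ℓ t ω x).card * 2 ^ t) := by
          rw [sum_const, card_univ, Fintype.card_fin, smul_eq_mul, Nat.mul_assoc]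
      _ ≤ n * 2 ^ n := Nat.mul_le_mul_left _ hω
  have hU₂le : U₂.card * 2 ^ ℓ ≤ n ^ 2 * 2 ^ n := card_collide hn h2l
  -- arithmetic
  have h1 : U₁.card * (2 * n) ≤ 2 ^ n := by
    have : U₁.card * (2 * n ^ 2) ≤ n * 2 ^ n := (Nat.mul_le_mul_left _ ht).trans hU₁le
    have e : U₁.card * (2 * n ^ 2) = (U₁.card * (2 * n)) * n := by ring
    rw [e, Nat.mul_comm n] at this
    exact Nat.le_of_mul_le_mul_right this hn
  have h2 : U₂.card * (2 * n) ≤ 2 ^ n := by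
    have : U₂.card * (2 * n ^ 3) ≤ n ^ 2 * 2 ^ n := (Nat.mul_le_mul_left _ hl).trans hU₂le
    have e : U₂.card * (2 * n ^ 3) = (U₂.card * (2 * n)) * n ^ 2 := by ring
    rw [e, Nat.mul_comm (n ^ 2)] at this
    exact Nat.le_of_mul_le_mul_right this (by positivity)
  have h3 : (univ.filter fun x : Fin n → Bool => fireCount (elect hn ℓ t ω) x ≠ 1).card * (2 * n) ≤
      2 * 2 ^ n := by
    calc (univ.filter fun x : Fin n → Bool => fireCount (elect hn ℓ t ω) x ≠ 1).card * (2 * n)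
        ≤ (U₁ ∪ U₂).card * (2 * n) := Nat.mul_le_mul_right _ (card_le_card hsub)
      _ ≤ (U₁.card + U₂.card) * (2 * n) := Nat.mul_le_mul_right _ (card_union_le _ _)
      _ = U₁.card * (2 * n) + U₂.card * (2 * n) := Nat.add_mul _ _ _
      _ ≤ 2 ^ n + 2 ^ n := Nat.add_le_add h1 h2
      _ = 2 * 2 ^ n := by ring
  have e : (univ.filter fun x : Fin n → Bool => fireCount (elect hn ℓ t ω) x ≠ 1).card * (2 * n) =
      2 * ((univ.filter fun x : Fin n → Bool => fireCount (elect hn ℓ t ω) x ≠ 1).card * n) := by ring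
  rw [e] at h3
  exact Nat.le_of_mul_le_mul_left h3 (by norm_num)

/-- `6L + 8 ≤ 2^L` for `L ≥ 6`. -/
theorem six_mul_add_eight_le_two_pow {L : ℕ} (hL : 6 ≤ L) : 6 * L + 8 ≤ 2 ^ L := by
  induction L, hL using Nat.le_induction with
  | base => norm_num
  | succ L hL ih =>
    have : 6 ≤ 2 ^ L := le_trans (by norm_num) (Nat.pow_le_pow_right (by norm_num) hL)
    rw [pow_succ]; omega

/-- **Leader election at fixed `n ≥ 64`**: degree `(log₂ n)^4`, failure `≤ 1/n`. -/
theorem leaderElect (n : ℕ) (hn64 : 64 ≤ n) : LeaderElect n ((Nat.log 2 n) ^ 4) (1 / n) := by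
  have hn : 0 < n := by omega
  set L := Nat.log 2 n with hL
  have hL6 : 6 ≤ L := Nat.le_log_of_pow_le (by norm_num) (by simpa using hn64)
  have hnL : n < 2 ^ (L + 1) := Nat.lt_pow_succ_log_self (by norm_num) n
  have hLn : 2 ^ L ≤ n := Nat.pow_log_le_self 2 (by omega)
  set t := 2 * L + 3 with ht
  set ℓ := 3 * L + 4 with hl
  have h2l : 2 * ℓ ≤ n := by
    have := six_mul_add_eight_le_two_pow hL6
    omega
  have htb : 2 * n ^ 2 ≤ 2 ^ t := by
    have h1 : n ^ 2 < (2 ^ (L + 1)) ^ 2 := Nat.pow_lt_pow_left hnL (by norm_num)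
    have e : 2 ^ t = 2 * (2 ^ (L + 1)) ^ 2 := by rw [ht]; ring
    rw [e]; omega
  have hlb : 2 * n ^ 3 ≤ 2 ^ ℓ := by
    have h1 : n ^ 3 < (2 ^ (L + 1)) ^ 3 := Nat.pow_lt_pow_left hnL (by norm_num)
    have e : 2 ^ ℓ = 2 * (2 ^ (L + 1)) ^ 3 := by rw [hl]; ring
    rw [e]; omega
  obtain ⟨ω, hω⟩ := exists_good_seed hn ℓ t
  have hdeg : t * (ℓ + 1) ≤ L ^ 4 := by
    have h1 : 2 * L + 3 ≤ L * L := by nlinarith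
    have h2 : 3 * L + 5 ≤ L * L := by nlinarith
    calc t * (ℓ + 1) = (2 * L + 3) * (3 * L + 5) := by rw [ht, hl]
      _ ≤ (L * L) * (L * L) := Nat.mul_le_mul h1 h2
      _ = L ^ 4 := by ring
  refine ⟨elect hn ℓ t ω, lowDeg_mono hdeg (elect_mem hn ℓ t ω), ?_⟩
  have hbad := card_bad_mul_le hn h2l htb hlb hω
  have hnR : (0 : ℝ) < n := by exact_mod_cast hn
  have hbadR : ((univ.filter fun x : Fin n → Bool => fireCount (elect hn ℓ t ω) x ≠ 1).card : ℝ) *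
      n ≤ (2 : ℝ) ^ n := by exact_mod_cast hbad
  rw [one_div, inv_mul_eq_div, le_div_iff₀ hnR]
  exact hbadR

end LeaderElection

/-- **`LowDegLeaderElection` — PROVED** (`C = 4`, `n₀ = 64`): a single polynomial of degree
`≤ (log₂ n)^4` fires at exactly one rotation of all but a `1/n` fraction of the patterns. -/
theorem lowDegLeaderElection : LowDegLeaderElection :=
  ⟨4, 64, fun n hn => LeaderElection.leaderElect n hn⟩

end Summit.QuantumAdvantage.AdviceFreeQNC0
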